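/-
Copyright: the b2b-balaban T⁴-continuum CRUX team, row NE7b leaf lineage `t4-ne7b-formalise-leaf-03` (gen 147). Project licence.
-/
import Mathlib.Analysis.Calculus.InverseFunctionTheorem.ContDiff
import Mathlib.Analysis.Calculus.ContDiff.RCLike
import Mathlib.Analysis.Calculus.FDeriv.CompCLM
import Mathlib.Analysis.Normed.Module.FiniteDimension
import Mathlib.Analysis.Normed.Operator.Banach
import Mathlib.Analysis.Normed.Operator.Bilinear
import Mathlib.LinearAlgebra.Dual.Lemmas
import Mathlib.Order.ConditionallyCompleteLattice.Indexed

/-!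
# THE HARD STEP PRESERVES SMOOTHNESS — NONLINEAR CONSTRAINT: the KKT pairs `(δ, λ)` (`G δ = w`, `DV(δ) = λ ∘ DG(δ)`) of
# `C^{n+1}` data form a `Cⁿ` BRANCH `w ↦ (δ(w), λ(w))` through every non-degenerate one (inverse function theorem on the
# Lagrange map `(δ, λ) ↦ (G δ, DV(δ) − λ ∘ DG(δ))`), the value along the branch is `C^{n+1}` with `D(V ∘ δ)(w) = λ(w)` — THE
# DERIVATIVE OF THE VALUE IS THE MULTIPLIER — and, wherever the branch minimises on the nonlinear fibre (this lineage's
# `ConstrainedValueLagrangian.isMinOn_fibre_of_firstOrderG` supplies it), the value function `φ w = ⨅ {V δ : G δ = w}` is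
# `C^{n+1}` (row NE7b, node U5c; TRANSFER row (xxiv) (L2)'s REGULARITY clause; [folklore] Fiacco's basic sensitivity theorem)

Cell `pub-balaban`, sub-cell `t4`, spine estimate NE7b (`T4WeightBudget.RelWeightBound`; NOT PRINTED in [Bałaban 1983–89],
NOT PROVED).  Crux-route work under `Spine/NE7b/` by leaf-03 (CRUX team (2), FREEZE (0) crux-prover clause).  NOTHING of
Bałaban's is named, asserted, valued or discharged.  Mathlib only; no `def`; zero `sorry`.

WHY.  `ConstrainedMinimiserRegular` (CMR, p379513, this seat) types T-85 (L1)'s regularity clause for a LINEAR constraint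
`D`; the SU(2) road's averaging constraint is NONLINEAR (T-85 §3: `Q_k(U₀, ηA) = Q_k(U₀)A + C_k(U₀, A)`), and this lineage's
`ConstrainedValueLagrangian` (CVL, p378628) ∕ `ConstrainedValueSection` (CVSec, p378846) ∕ `…LagrangianHessian` (CVLH) type
(L2)'s EXPANSION at `w₀` with the honest rider that the minimiser's and the multiplier's smooth dependence on `w` — and one
more derivative of `φ` than the expansion shows — is NOT HERE.  This file types it: Lusternik's device again, now on the
Lagrange map in the unknowns `(δ, λ) ∈ E × F^*`, values in `F × E^*` — same dimension — whose derivative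
`(h, μ) ↦ (Th, 𝓛h − μ ∘ T)` (`T = DG(δ₀)`, `𝓛 = D²V(δ₀) − Λ₀ ∘ D²G(δ₀)` the LAGRANGIAN Hessian of CVL ∕ CVLH) is injective
exactly when `T` is onto and `𝓛` is non-degenerate on `ker T`.

WHAT IS PROVED ([folklore]: Fiacco, *Introduction to Sensitivity and Stability Analysis in Nonlinear Programming* (1983)
Thm 2.1; Bonnans–Shapiro (2000) §4.7; Luenberger–Ye, *Linear and Nonlinear Programming* §13.1 «sensitivity: ∇φ = λ»).
`E`, `F` finite-dimensional real normed spaces; `V : E → ℝ`, `G : E → F` of class `C^{n+1}` at `δ₀` (`1 ≤ n`).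
* §1 `finrank_prod_dual_comm` (`dim (E × F^*) = dim (F × E^*)`), `ker_lagrangeDeriv_eq_bot` (injectivity of
  `(h, μ) ↦ (Th, V″h − Λ₀ ∘ G″h − μ ∘ T)` from `T` onto + `𝓛` non-degenerate on `ker T`).
* §2 **`exists_contDiffAt_kktBranch`** — THE BRANCH: `DG(δ₀)` onto, KKT at `δ₀` (`DV(δ₀) = Λ₀ ∘ DG(δ₀)`), `𝓛` non-degenerate
  on `ker DG(δ₀)` ⟹ `∃ δ : F → E, Λ : F → F^*` with `δ(Gδ₀) = δ₀`, `Λ(Gδ₀) = Λ₀`, both `Cⁿ` at `Gδ₀`, EVENTUALLY in `w`: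
  `G(δ w) = w ∧ DV(δ w) = Λ w ∘ DG(δ w)`, and EVENTUALLY in `(δ′, λ′)`: every KKT pair near `(δ₀, Λ₀)` lies on the branch.
* §3 `hasFDerivAt_comp_kktBranch` — along ANY `δ` with `G ∘ δ = id` near `w`, `δ` differentiable at `w` and KKT at `δ w`
  with multiplier `μ`: `HasFDerivAt (V ∘ δ) μ w` (**the derivative of the value is the multiplier**; `DG(δ w) ∘ Dδ(w) = id` by
  `HasFDerivAt.unique`); **`contDiffAt_comp_kktBranch`** — `V ∘ δ` is `C^{n+1}` at `w₀` (its derivative `Λ` is `Cⁿ`).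
* §4 `iInf_fibreG_eq_of_isMinOn`, **`contDiffAt_constrValueG`** — THE END: with the DISPLAYED identification «the branch
  minimises on the nonlinear fibre near `w₀`» (`∀ᶠ w, IsMinOn V {δ′ : G δ′ = w} (δ w)`; CVL §2's `isMinOn_fibre_of_firstOrderG`
  at `δ w` is the road's supplier) the value `w ↦ ⨅ δ′ : {δ′ // G δ′ = w}, V δ′` (CVL's currency) is `C^{n+1}` at `Gδ₀` and
  `hasFDerivAt_constrValueG`: EVENTUALLY `HasFDerivAt φ (Λ w) w`.
* §5 toy (`example`): `E = F = ℝ`, `G = id`: `φ = V`, multiplier `λ(w) = DV(w)`.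

NOT HERE (honest): the minimiser identification itself (displayed; CVL's global letters or second-order sufficiency + a
window); the LINEAR case is CMR (constant `DG`, no multiplier unknown needed); the Hessian identity `D²φ(w₀) = 𝓛`-Schur
complement (CVLH, Peano side); infinite dimension; which `V, G` are Bałaban's ((A3) ∕ (A1c), NC-NE7b-α UNRULED).  BY-NAME
EFFECT ON THE WALL: NONE.  NE7b NOT PRINTED ∕ NOT PROVED; spine PROVED 0∕9; rung (B)+1 on a FINITE torus — NOT infinite
volume, NOT the mass gap, NOT Clay.  HONEST DEPENDENCY: continuum YM on T⁴ ⇐ BetaPertH ∧ nine spine estimates (0/9 proved);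
BetaPertH ⇐ (D1) ∧ (D4) ∧ CAP+tail; G-an2-4 gates asym, D1 and NE2∕3∕4.
-/

set_option autoImplicit false

noncomputable section

namespace Summit.QuantumFields.BalabanUV.T4Continuum.NE7b.ConstrainedMinimiserRegularNonlinear

open Set Filter Topology Function

variable {E F : Type*} [NormedAddCommGroup E] [NormedSpace ℝ E] [NormedAddCommGroup F] [NormedSpace ℝ F]

/-! ## §1. Linear algebra of the Lagrange map's derivative -/

section Branch

variable [FiniteDimensional ℝ E] [FiniteDimensional ℝ F]

/-- `dim (E × F^*) = dim (F × E^*)` (`dim X^* = dim X` for the continuous duals in finite dimension). [folklore] -/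
theorem finrank_prod_dual_comm :
    Module.finrank ℝ (E × (F →L[ℝ] ℝ)) = Module.finrank ℝ (F × (E →L[ℝ] ℝ)) := by
  have hE : Module.finrank ℝ (E →L[ℝ] ℝ) = Module.finrank ℝ E := by
    rw [← LinearEquiv.finrank_eq (LinearMap.toContinuousLinearMap : (E →ₗ[ℝ] ℝ) ≃ₗ[ℝ] (E →L[ℝ] ℝ))]
    exact Subspace.dual_finrank_eq
  have hF : Module.finrank ℝ (F →L[ℝ] ℝ) = Module.finrank ℝ F := by
    rw [← LinearEquiv.finrank_eq (LinearMap.toContinuousLinearMap : (F →ₗ[ℝ] ℝ) ≃ₗ[ℝ] (F →L[ℝ] ℝ))]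
    exact Subspace.dual_finrank_eq
  rw [Module.finrank_prod, Module.finrank_prod, hE, hF, add_comm]

omit [FiniteDimensional ℝ E] [FiniteDimensional ℝ F] in
/-- **Injectivity of the Lagrange derivative.**  `T : E →L F` onto, `V″ : E →L E →L ℝ`, `G″ : E →L E →L F`, `Λ₀ : F →L ℝ`,
and the Lagrangian Hessian `𝓛[k, k′] = V″ k k′ − Λ₀ (G″ k k′)` non-degenerate on `ker T`.  Then the derivative of the
Lagrange map, `(h, μ) ↦ (T h, V″ h − (Λ₀ ∘ G″ h + μ ∘ T))`, is injective: `Th = 0` and `𝓛h = μ ∘ T` on `E` force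
`𝓛h|_{ker T} = 0`, so `h = 0`; then `μ ∘ T = 0` with `T` onto forces `μ = 0`. [folklore] -/
theorem ker_lagrangeDeriv_eq_bot (T : E →L[ℝ] F) (hT : Surjective T) (V'' : E →L[ℝ] E →L[ℝ] ℝ)
    (G'' : E →L[ℝ] E →L[ℝ] F) (Λ₀ : F →L[ℝ] ℝ)
    (hnd : ∀ k ∈ T.ker, (∀ k' ∈ T.ker, V'' k k' - Λ₀ (G'' k k') = 0) → k = 0) :
    ((T.comp (ContinuousLinearMap.fst ℝ E (F →L[ℝ] ℝ))).prod
        (V''.comp (ContinuousLinearMap.fst ℝ E (F →L[ℝ] ℝ))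
          - (((ContinuousLinearMap.compL ℝ E F ℝ) Λ₀).comp (G''.comp (ContinuousLinearMap.fst ℝ E (F →L[ℝ] ℝ)))
              + ((ContinuousLinearMap.compL ℝ E F ℝ).flip T).comp (ContinuousLinearMap.snd ℝ E (F →L[ℝ] ℝ))))).ker
      = ⊥ := by
  rw [LinearMap.ker_eq_bot']
  rintro ⟨h, μ⟩ hh
  have h1 : T h = 0 := congrArg Prod.fst hh
  have h2 := congrArg Prod.snd hh
  -- `h2 : V'' h − (Λ₀ ∘ G'' h + μ ∘ T) = 0`
  have h2' : ∀ x : E, V'' h x - (Λ₀ (G'' h x) + μ (T x)) = 0 := fun x => by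
    have h3 := congrArg (fun L : E →L[ℝ] ℝ => L x) h2
    simpa using h3
  have hh0 : h = 0 := by
    refine hnd h h1 fun k' hk' => ?_
    have h4 := h2' k'
    rw [show T k' = 0 from hk', map_zero, add_zero] at h4
    exact h4
  subst hh0
  have hμ : μ = 0 := by
    ext y
    obtain ⟨x, rfl⟩ := hT y
    have h4 := h2' x
    simpa using h4
  subst hμ
  rfl

/-! ## §2. The `Cⁿ` branch of KKT pairs (inverse function theorem on the Lagrange map) -/

/-- **THE `Cⁿ` BRANCH OF KKT PAIRS.**  `E`, `F` finite-dimensional; `V : E → ℝ` and `G : E → F` of class `C^{n+1}` at `δ₀`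
(`1 ≤ n`); `DG(δ₀)` ONTO; KKT at `δ₀` with multiplier `Λ₀` (`DV(δ₀) = Λ₀ ∘ DG(δ₀)`); the Lagrangian Hessian
`D²V(δ₀) − Λ₀ ∘ D²G(δ₀)` non-degenerate on `ker DG(δ₀)`.  Then there are `δ : F → E`, `Λ : F → (F →L ℝ)` with
`δ (Gδ₀) = δ₀`, `Λ (Gδ₀) = Λ₀`, both `Cⁿ` at `Gδ₀`, EVENTUALLY in `w → Gδ₀`: `G (δ w) = w` and `DV(δ w) = Λ w ∘ DG(δ w)`, and
EVENTUALLY in `p → (δ₀, Λ₀)`: if `p` is a KKT pair then `p = (δ (G p.1), Λ (G p.1))`. [folklore] -/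
theorem exists_contDiffAt_kktBranch {V : E → ℝ} {G : E → F} {δ₀ : E} {Λ₀ : F →L[ℝ] ℝ} {n : ℕ} (hn : 1 ≤ n)
    (hV : ContDiffAt ℝ (n + 1) V δ₀) (hG : ContDiffAt ℝ (n + 1) G δ₀) (hT : Surjective (fderiv ℝ G δ₀))
    (hkkt : fderiv ℝ V δ₀ = Λ₀.comp (fderiv ℝ G δ₀))
    (hnd : ∀ k ∈ (fderiv ℝ G δ₀).ker, (∀ k' ∈ (fderiv ℝ G δ₀).ker,
      fderiv ℝ (fderiv ℝ V) δ₀ k k' - Λ₀ (fderiv ℝ (fderiv ℝ G) δ₀ k k') = 0) → k = 0) :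
    ∃ (δ : F → E) (Λ : F → (F →L[ℝ] ℝ)), δ (G δ₀) = δ₀ ∧ Λ (G δ₀) = Λ₀ ∧
      ContDiffAt ℝ n δ (G δ₀) ∧ ContDiffAt ℝ n Λ (G δ₀) ∧
      (∀ᶠ w in 𝓝 (G δ₀), G (δ w) = w ∧ fderiv ℝ V (δ w) = (Λ w).comp (fderiv ℝ G (δ w))) ∧
      (∀ᶠ p in 𝓝 (δ₀, Λ₀), fderiv ℝ V p.1 = p.2.comp (fderiv ℝ G p.1) → (δ (G p.1), Λ (G p.1)) = p) := by
  haveI : CompleteSpace (E × (F →L[ℝ] ℝ)) := FiniteDimensional.complete ℝ _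
  haveI : CompleteSpace (F × (E →L[ℝ] ℝ)) := FiniteDimensional.complete ℝ _
  -- the Lagrange map and its derivative
  set Φ : E × (F →L[ℝ] ℝ) → F × (E →L[ℝ] ℝ) :=
    fun p => (G p.1, fderiv ℝ V p.1 - p.2.comp (fderiv ℝ G p.1)) with hΦ
  set T := fderiv ℝ G δ₀ with hTdef
  set V'' := fderiv ℝ (fderiv ℝ V) δ₀ with hV''
  set G'' := fderiv ℝ (fderiv ℝ G) δ₀ with hG''
  set pfst := ContinuousLinearMap.fst ℝ E (F →L[ℝ] ℝ) with hpfst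
  set psnd := ContinuousLinearMap.snd ℝ E (F →L[ℝ] ℝ) with hpsnd
  set Φ' := (T.comp pfst).prod (V''.comp pfst
      - (((ContinuousLinearMap.compL ℝ E F ℝ) Λ₀).comp (G''.comp pfst)
          + ((ContinuousLinearMap.compL ℝ E F ℝ).flip T).comp psnd)) with hΦ'
  have hΦp₀ : Φ (δ₀, Λ₀) = (G δ₀, 0) := by
    simp only [hΦ, hkkt, hTdef, sub_self]
  have hkkt_iff : ∀ p : E × (F →L[ℝ] ℝ), Φ p = (G p.1, 0) ↔ fderiv ℝ V p.1 = p.2.comp (fderiv ℝ G p.1) := fun p => by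
    simp only [hΦ, Prod.mk.injEq, true_and, sub_eq_zero]
  -- smoothness of Φ
  have hn0 : (n : WithTop ℕ∞) ≠ 0 := by exact_mod_cast (Nat.one_le_iff_ne_zero.mp hn)
  have hle : (n : WithTop ℕ∞) ≤ n + 1 := le_self_add
  have hdV : ContDiffAt ℝ n (fderiv ℝ V) δ₀ := hV.fderiv_right (by norm_cast)
  have hdG : ContDiffAt ℝ n (fderiv ℝ G) δ₀ := hG.fderiv_right (by norm_cast)
  have hGn : ContDiffAt ℝ n G δ₀ := hG.of_le hle
  have hfst : ContDiffAt ℝ n (fun p : E × (F →L[ℝ] ℝ) => p.1) (δ₀, Λ₀) := contDiffAt_fst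
  have hsnd : ContDiffAt ℝ n (fun p : E × (F →L[ℝ] ℝ) => p.2) (δ₀, Λ₀) := contDiffAt_snd
  have hΦcd : ContDiffAt ℝ n Φ (δ₀, Λ₀) := by
    refine (hGn.comp (δ₀, Λ₀) hfst).prodMk ((hdV.comp (δ₀, Λ₀) hfst).sub ?_)
    exact hsnd.clm_comp (hdG.comp (δ₀, Λ₀) hfst)
  -- the derivative of Φ at (δ₀, Λ₀)
  have hGd : HasFDerivAt G T δ₀ := (hG.differentiableAt (by exact_mod_cast Nat.succ_ne_zero n)).hasFDerivAt
  have hdVd : HasFDerivAt (fderiv ℝ V) V'' δ₀ := (hdV.differentiableAt hn0).hasFDerivAt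
  have hdGd : HasFDerivAt (fderiv ℝ G) G'' δ₀ := (hdG.differentiableAt hn0).hasFDerivAt
  have hfstd : HasFDerivAt (fun p : E × (F →L[ℝ] ℝ) => p.1) pfst (δ₀, Λ₀) := hasFDerivAt_fst
  have hsndd : HasFDerivAt (fun p : E × (F →L[ℝ] ℝ) => p.2) psnd (δ₀, Λ₀) := hasFDerivAt_snd
  have hΦd : HasFDerivAt Φ Φ' (δ₀, Λ₀) := by
    have h1 : HasFDerivAt (fun p : E × (F →L[ℝ] ℝ) => G p.1) (T.comp pfst) (δ₀, Λ₀) := hGd.comp (δ₀, Λ₀) hfstd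
    have h2 : HasFDerivAt (fun p : E × (F →L[ℝ] ℝ) => fderiv ℝ V p.1) (V''.comp pfst) (δ₀, Λ₀) :=
      hdVd.comp (δ₀, Λ₀) hfstd
    have h3 : HasFDerivAt (fun p : E × (F →L[ℝ] ℝ) => fderiv ℝ G p.1) (G''.comp pfst) (δ₀, Λ₀) :=
      hdGd.comp (δ₀, Λ₀) hfstd
    have h4 := hsndd.clm_comp h3
    exact h1.prodMk (h2.sub h4)
  -- the derivative is an isomorphism
  have hinj : Φ'.ker = ⊥ := ker_lagrangeDeriv_eq_bot T hT V'' G'' Λ₀ hnd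
  have hsurj : Φ'.range = ⊤ :=
    LinearMap.range_eq_top.mpr
      ((LinearMap.injective_iff_surjective_of_finrank_eq_finrank finrank_prod_dual_comm).mp
        (LinearMap.ker_eq_bot.mp hinj))
  set Φe := ContinuousLinearEquiv.ofBijective Φ' hinj hsurj with hΦe
  have hΦe' : HasFDerivAt Φ (Φe : E × (F →L[ℝ] ℝ) →L[ℝ] F × (E →L[ℝ] ℝ)) (δ₀, Λ₀) := by
    rw [hΦe, ContinuousLinearEquiv.coe_ofBijective]; exact hΦd
  -- inverse function theorem
  have hstrict := hΦcd.hasStrictFDerivAt' hΦe' hn0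
  set Ψ := hΦcd.localInverse hΦe' hn0 with hΨ
  have hΨcd : ContDiffAt ℝ n Ψ (Φ (δ₀, Λ₀)) := hΦcd.to_localInverse hΦe' hn0
  have hΨ0 : Ψ (Φ (δ₀, Λ₀)) = (δ₀, Λ₀) := hΦcd.localInverse_apply_image hΦe' hn0
  have hleft : ∀ᶠ p in 𝓝 (δ₀, Λ₀), Ψ (Φ p) = p := hstrict.eventually_left_inverse
  have hright : ∀ᶠ y in 𝓝 (Φ (δ₀, Λ₀)), Φ (Ψ y) = y := hstrict.eventually_right_inverse
  have hj : Continuous fun w : F => ((w, (0 : E →L[ℝ] ℝ)) : F × (E →L[ℝ] ℝ)) := continuous_id.prodMk continuous_const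
  have hΨcd' : ContDiffAt ℝ n (fun w : F => Ψ (w, 0)) (G δ₀) := by
    have h1 : ContDiffAt ℝ n Ψ (G δ₀, (0 : E →L[ℝ] ℝ)) := by rw [← hΦp₀]; exact hΨcd
    exact h1.comp (G δ₀) (contDiffAt_id.prodMk contDiffAt_const)
  refine ⟨fun w => (Ψ (w, 0)).1, fun w => (Ψ (w, 0)).2, ?_, ?_, ?_, ?_, ?_, ?_⟩
  · show (Ψ (G δ₀, 0)).1 = δ₀
    rw [← hΦp₀, hΨ0]
  · show (Ψ (G δ₀, 0)).2 = Λ₀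
    rw [← hΦp₀, hΨ0]
  · exact contDiffAt_fst.comp (G δ₀) hΨcd'
  · exact contDiffAt_snd.comp (G δ₀) hΨcd'
  · have ht : Tendsto (fun w : F => ((w, (0 : E →L[ℝ] ℝ)) : F × (E →L[ℝ] ℝ))) (𝓝 (G δ₀)) (𝓝 (Φ (δ₀, Λ₀))) := by
      rw [hΦp₀]; exact hj.continuousAt
    filter_upwards [ht.eventually hright] with w hw
    have h1 : G (Ψ (w, 0)).1 = w := congrArg Prod.fst hw
    refine ⟨h1, (hkkt_iff (Ψ (w, 0))).mp ?_⟩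
    rw [hw, h1]
  · filter_upwards [hleft] with p hp hk
    have : Φ p = (G p.1, 0) := (hkkt_iff p).mpr hk
    rw [← this, hp]

end Branch

/-! ## §3. The value along the branch: its derivative is the multiplier, hence one more derivative -/

/-- **THE DERIVATIVE OF THE VALUE IS THE MULTIPLIER.**  If `G (δ w′) = w′` for `w′` near `w`, `δ` is differentiable at `w`,
`V`, `G` are differentiable at `δ w` and the KKT condition holds there with multiplier `μ` (`DV(δ w) = μ ∘ DG(δ w)`), then
`HasFDerivAt (V ∘ δ) μ w` — because `DG(δ w) ∘ Dδ(w) = id` (`HasFDerivAt.unique` on `G ∘ δ =ᶠ id`). [folklore] -/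
theorem hasFDerivAt_comp_kktBranch {V : E → ℝ} {G : E → F} {δ : F → E} {w : F} {μ : F →L[ℝ] ℝ}
    (hGδ : ∀ᶠ w' in 𝓝 w, G (δ w') = w') (hδ : DifferentiableAt ℝ δ w) (hVd : DifferentiableAt ℝ V (δ w))
    (hGd : DifferentiableAt ℝ G (δ w)) (hkkt : fderiv ℝ V (δ w) = μ.comp (fderiv ℝ G (δ w))) :
    HasFDerivAt (V ∘ δ) μ w := by
  have hchain : HasFDerivAt (V ∘ δ) ((fderiv ℝ V (δ w)).comp (fderiv ℝ δ w)) w :=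
    hVd.hasFDerivAt.comp w hδ.hasFDerivAt
  have hGs : HasFDerivAt (fun w' => G (δ w')) ((fderiv ℝ G (δ w)).comp (fderiv ℝ δ w)) w :=
    hGd.hasFDerivAt.comp w hδ.hasFDerivAt
  have hid : HasFDerivAt (fun w' => G (δ w')) (ContinuousLinearMap.id ℝ F) w :=
    (hasFDerivAt_id w).congr_of_eventuallyEq (hGδ.mono fun w' hw' => by simp [hw'])
  have hGδ' : (fderiv ℝ G (δ w)).comp (fderiv ℝ δ w) = ContinuousLinearMap.id ℝ F := hGs.unique hid
  have heq : (fderiv ℝ V (δ w)).comp (fderiv ℝ δ w) = μ := by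
    rw [hkkt, ContinuousLinearMap.comp_assoc, hGδ', ContinuousLinearMap.comp_id]
  rw [← heq]; exact hchain

/-- **THE VALUE ALONG THE BRANCH IS `C^{n+1}`** when the multiplier map `Λ` is `Cⁿ` at `w₀` and, eventually in `w`, the value
`V ∘ δ` has derivative `Λ w` (§2 + `hasFDerivAt_comp_kktBranch`). [folklore] -/
theorem contDiffAt_of_hasFDerivAt_eventually {f : F → ℝ} {Λ : F → (F →L[ℝ] ℝ)} {w₀ : F} {n : ℕ}
    (hf : ∀ᶠ w in 𝓝 w₀, HasFDerivAt f (Λ w) w) (hΛ : ContDiffAt ℝ n Λ w₀) : ContDiffAt ℝ (n + 1) f w₀ := by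
  rw [show ((n : WithTop ℕ∞) + 1) = ((n + 1 : ℕ) : WithTop ℕ∞) by norm_cast] at *
  rw [show ((n + 1 : ℕ) : WithTop ℕ∞) = (n : WithTop ℕ∞) + 1 by norm_cast, contDiffAt_succ_iff_hasFDerivAt]
  obtain ⟨u, hu, hu'⟩ := eventually_iff_exists_mem.mp hf
  exact ⟨Λ, ⟨u, hu, hu'⟩, hΛ⟩

/-- `V ∘ δ` is `C^{n+1}` at `w₀` along a KKT branch: `G ∘ δ = id` and KKT eventually, `δ` differentiable near `w₀`, `V`, `G`
differentiable near `δ w₀` with `δ` continuous at `w₀`, `Λ` of class `Cⁿ` at `w₀`. [folklore] -/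
theorem contDiffAt_comp_kktBranch {V : E → ℝ} {G : E → F} {δ : F → E} {Λ : F → (F →L[ℝ] ℝ)} {w₀ : F} {n : ℕ}
    (hbr : ∀ᶠ w in 𝓝 w₀, G (δ w) = w ∧ fderiv ℝ V (δ w) = (Λ w).comp (fderiv ℝ G (δ w)))
    (hδd : ∀ᶠ w in 𝓝 w₀, DifferentiableAt ℝ δ w) (hVd : ∀ᶠ w in 𝓝 w₀, DifferentiableAt ℝ V (δ w))
    (hGd : ∀ᶠ w in 𝓝 w₀, DifferentiableAt ℝ G (δ w)) (hΛ : ContDiffAt ℝ n Λ w₀) :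
    ContDiffAt ℝ (n + 1) (V ∘ δ) w₀ := by
  refine contDiffAt_of_hasFDerivAt_eventually ?_ hΛ
  filter_upwards [eventually_eventually_nhds.mpr hbr, hbr, hδd, hVd, hGd] with w hbrw hw hδw hVw hGw
  exact hasFDerivAt_comp_kktBranch (hbrw.mono fun w' hw' => hw'.1) hδw hVw hGw hw.2

/-! ## §4. The value FUNCTION on the nonlinear fibres, where the branch minimises -/

omit [NormedAddCommGroup E] [NormedSpace ℝ E] [NormedAddCommGroup F] [NormedSpace ℝ F] in
/-- `⨅ δ′ : {δ′ // G δ′ = w}, V δ′ = V (δ w)` where `G (δ w) = w` and `δ w` minimises on the fibre. [folklore] -/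
theorem iInf_fibreG_eq_of_isMinOn {V : E → ℝ} {G : E → F} {δ : F → E} {w : F} (hGδ : G (δ w) = w)
    (hmin : IsMinOn V {δ' | G δ' = w} (δ w)) : (⨅ δ' : {δ' // G δ' = w}, V δ'.1) = V (δ w) := by
  haveI : Nonempty {δ' // G δ' = w} := ⟨⟨δ w, hGδ⟩⟩
  have hle : ∀ δ' : {δ' // G δ' = w}, V (δ w) ≤ V δ'.1 := fun δ' => hmin δ'.2
  have hbdd : BddBelow (range fun δ' : {δ' // G δ' = w} => V δ'.1) :=
    ⟨V (δ w), by rintro _ ⟨δ', rfl⟩; exact hle δ'⟩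
  exact le_antisymm (ciInf_le hbdd ⟨δ w, hGδ⟩) (le_ciInf hle)

/-- **EVENTUALLY `Dφ(w) = Λ w`** — the multiplier IS the derivative of the value function `φ w = ⨅ {V δ′ : G δ′ = w}`, along
a KKT branch that minimises on the fibres near `w₀` (displayed). [folklore] -/
theorem hasFDerivAt_constrValueG {V : E → ℝ} {G : E → F} {δ : F → E} {Λ : F → (F →L[ℝ] ℝ)} {w₀ : F}
    (hbr : ∀ᶠ w in 𝓝 w₀, G (δ w) = w ∧ fderiv ℝ V (δ w) = (Λ w).comp (fderiv ℝ G (δ w)))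
    (hmin : ∀ᶠ w in 𝓝 w₀, IsMinOn V {δ' | G δ' = w} (δ w))
    (hδd : ∀ᶠ w in 𝓝 w₀, DifferentiableAt ℝ δ w) (hVd : ∀ᶠ w in 𝓝 w₀, DifferentiableAt ℝ V (δ w))
    (hGd : ∀ᶠ w in 𝓝 w₀, DifferentiableAt ℝ G (δ w)) :
    ∀ᶠ w in 𝓝 w₀, HasFDerivAt (fun w => ⨅ δ' : {δ' // G δ' = w}, V δ'.1) (Λ w) w := by
  have hev : ∀ᶠ w in 𝓝 w₀, (⨅ δ' : {δ' // G δ' = w}, V δ'.1) = V (δ w) := by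
    filter_upwards [hbr, hmin] with w hw hm
    exact iInf_fibreG_eq_of_isMinOn hw.1 hm
  filter_upwards [eventually_eventually_nhds.mpr hbr, eventually_eventually_nhds.mpr hev, hbr, hδd, hVd, hGd]
    with w hbrw hevw hw hδw hVw hGw
  have h := hasFDerivAt_comp_kktBranch (hbrw.mono fun w' hw' => hw'.1) hδw hVw hGw hw.2
  exact h.congr_of_eventuallyEq (hevw.mono fun w' hw' => by simpa [Function.comp] using hw')

/-- **THE VALUE FUNCTION ON THE NONLINEAR FIBRES IS `C^{n+1}` ALONG A `Cⁿ` KKT BRANCH THAT MINIMISES** (finite dimension not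
needed here; the branch letter = §2's conclusion, the minimising letter displayed):
`ContDiffAt ℝ (n + 1) (fun w => ⨅ δ′ : {δ′ // G δ′ = w}, V δ′) w₀`. [folklore] -/
theorem contDiffAt_constrValueG {V : E → ℝ} {G : E → F} {δ : F → E} {Λ : F → (F →L[ℝ] ℝ)} {w₀ : F} {n : ℕ}
    (hbr : ∀ᶠ w in 𝓝 w₀, G (δ w) = w ∧ fderiv ℝ V (δ w) = (Λ w).comp (fderiv ℝ G (δ w)))
    (hmin : ∀ᶠ w in 𝓝 w₀, IsMinOn V {δ' | G δ' = w} (δ w))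
    (hδd : ∀ᶠ w in 𝓝 w₀, DifferentiableAt ℝ δ w) (hVd : ∀ᶠ w in 𝓝 w₀, DifferentiableAt ℝ V (δ w))
    (hGd : ∀ᶠ w in 𝓝 w₀, DifferentiableAt ℝ G (δ w)) (hΛ : ContDiffAt ℝ n Λ w₀) :
    ContDiffAt ℝ (n + 1) (fun w => ⨅ δ' : {δ' // G δ' = w}, V δ'.1) w₀ :=
  contDiffAt_of_hasFDerivAt_eventually (hasFDerivAt_constrValueG hbr hmin hδd hVd hGd) hΛ

/-- **COROLLARY (the letters of §2 assembled):** finite dimension, `V`, `G` of class `C^{n+1}` at `δ₀` (`1 ≤ n`), `DG(δ₀)` onto,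
KKT at `δ₀` with `Λ₀`, Lagrangian Hessian non-degenerate on `ker DG(δ₀)`, and the DISPLAYED identification that the KKT branch
minimises on the fibres near `Gδ₀` — for EVERY branch `(δ, Λ)` with §2's letters (base point `(δ₀, Λ₀)`, both `Cⁿ` at
`Gδ₀`, EVENTUALLY `G (δ w) = w ∧ DV(δ w) = Λ w ∘ DG(δ w)`; so the caller need not know which branch §2 chose, and may feed
the KKT letter at `δ w` to a first-order minimisation supplier) — give: the value function is `C^{n+1}` at `Gδ₀`. [folklore] -/
theorem contDiffAt_constrValueG_of_kkt [FiniteDimensional ℝ E] [FiniteDimensional ℝ F] {V : E → ℝ} {G : E → F} {δ₀ : E}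
    {Λ₀ : F →L[ℝ] ℝ} {n : ℕ} (hn : 1 ≤ n) (hV : ContDiffAt ℝ (n + 1) V δ₀) (hG : ContDiffAt ℝ (n + 1) G δ₀)
    (hT : Surjective (fderiv ℝ G δ₀)) (hkkt : fderiv ℝ V δ₀ = Λ₀.comp (fderiv ℝ G δ₀))
    (hnd : ∀ k ∈ (fderiv ℝ G δ₀).ker, (∀ k' ∈ (fderiv ℝ G δ₀).ker,
      fderiv ℝ (fderiv ℝ V) δ₀ k k' - Λ₀ (fderiv ℝ (fderiv ℝ G) δ₀ k k') = 0) → k = 0)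
    (hmin : ∀ (δ : F → E) (Λ : F → (F →L[ℝ] ℝ)), δ (G δ₀) = δ₀ → Λ (G δ₀) = Λ₀ →
      ContDiffAt ℝ n δ (G δ₀) → ContDiffAt ℝ n Λ (G δ₀) →
      (∀ᶠ w in 𝓝 (G δ₀), G (δ w) = w ∧ fderiv ℝ V (δ w) = (Λ w).comp (fderiv ℝ G (δ w))) →
      ∀ᶠ w in 𝓝 (G δ₀), IsMinOn V {δ' | G δ' = w} (δ w)) :
    ContDiffAt ℝ (n + 1) (fun w => ⨅ δ' : {δ' // G δ' = w}, V δ'.1) (G δ₀) := by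
  obtain ⟨δ, Λ, hδ0, hΛ0, hδcd, hΛcd, hbr, -⟩ := exists_contDiffAt_kktBranch hn hV hG hT hkkt hnd
  have hn0 : (n : WithTop ℕ∞) ≠ 0 := by exact_mod_cast (Nat.one_le_iff_ne_zero.mp hn)
  have hn1 : ((n : WithTop ℕ∞) + 1) ≠ 0 := by exact_mod_cast Nat.succ_ne_zero n
  have hn1' : ((n : WithTop ℕ∞) + 1) ≠ ((⊤ : ℕ∞) : WithTop ℕ∞) := by exact_mod_cast ENat.coe_ne_top (n + 1)
  have hn' : (n : WithTop ℕ∞) ≠ ((⊤ : ℕ∞) : WithTop ℕ∞) := by exact_mod_cast ENat.coe_ne_top n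
  have hδc : ContinuousAt δ (G δ₀) := hδcd.continuousAt
  have hδd : ∀ᶠ w in 𝓝 (G δ₀), DifferentiableAt ℝ δ w :=
    (hδcd.eventually hn').mono fun w hw => hw.differentiableAt hn0
  have hVd : ∀ᶠ w in 𝓝 (G δ₀), DifferentiableAt ℝ V (δ w) := by
    have h1 : ∀ᶠ x in 𝓝 δ₀, DifferentiableAt ℝ V x :=
      (hV.eventually hn1').mono fun x hx => hx.differentiableAt hn1
    rw [← hδ0] at h1
    exact hδc.eventually h1
  have hGd : ∀ᶠ w in 𝓝 (G δ₀), DifferentiableAt ℝ G (δ w) := by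
    have h1 : ∀ᶠ x in 𝓝 δ₀, DifferentiableAt ℝ G x :=
      (hG.eventually hn1').mono fun x hx => hx.differentiableAt hn1
    rw [← hδ0] at h1
    exact hδc.eventually h1
  exact contDiffAt_constrValueG hbr (hmin δ Λ hδ0 hΛ0 hδcd hΛcd hbr) hδd hVd hGd hΛcd

/-! ## §5. Toy -/

/-- Toy: `E = F = ℝ`, `G = id` (`DG = id` onto, `ker = 0`), `V` of class `C^{n+1}`: KKT at `x` with `Λ₀ = DV(x)`; every
point is its own fibre, the branch is `δ = id` with `Λ = DV`, and the value function is `V` — the corollary returns `V`'s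
class. [folklore] -/
example {V : ℝ → ℝ} {x : ℝ} {n : ℕ} (hn : 1 ≤ n) (hV : ContDiffAt ℝ (n + 1) V x) :
    ContDiffAt ℝ (n + 1) (fun w => ⨅ δ' : {δ' // id δ' = w}, V δ'.1) (id x) := by
  have hG : ContDiffAt ℝ (n + 1) (id : ℝ → ℝ) x := contDiffAt_id
  have hfd : fderiv ℝ (id : ℝ → ℝ) x = ContinuousLinearMap.id ℝ ℝ := fderiv_id
  refine contDiffAt_constrValueG_of_kkt (Λ₀ := fderiv ℝ V x) hn hV hG ?_ ?_ ?_ ?_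
  · rw [hfd]; exact fun y => ⟨y, rfl⟩
  · rw [hfd, ContinuousLinearMap.comp_id]
  · intro k hk _
    rw [hfd] at hk
    simpa using hk
  · intro δ _ _ _ _ _ hbr
    filter_upwards [hbr] with w hw
    intro δ' hδ'
    have hw1 : δ w = w := hw.1
    simp only [id_eq, mem_setOf_eq] at hδ'
    rw [hδ', hw1]
    exact le_refl (V w)

end Summit.QuantumFields.BalabanUV.T4Continuum.NE7b.ConstrainedMinimiserRegularNonlinear

end
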